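import Mathlib
import Literature.NumberTheory.LFunctions.Zhang2022.AppendixALocalFactors
import HarnessLib

/-!
# Zhang (2022), Appendix A part 2 (ii): the local series `κ̃₁(qʳ,1)`, the `r`-sum, and the local form of (A.6)/(A.7) — kernel-checked

Topic `Literature/NumberTheory/LFunctions/Zhang2022` (Landau–Siegel audit tree; verdict-neutral).
Y. Zhang, *Discrete mean estimates and the Landau–Siegel zero*, arXiv:2211.02515v1 (2022)
[Zhang2022LandauSiegel] — **an unrefereed manuscript under adjudication**; this file PROVES finite /
absolutely convergent per-prime computations transcribed from its Appendix A (proof of Lemma 15.2,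
pp. 104–105) with explicit constants, and asserts nothing about its theorems. Companion of
`AppendixALocalFactors.lean` (notation `u = q⁻¹`, `v = χ(q)`, `x = q^{−β₁}`, `y = q^{−β₂}`, `κ₁`, `λ₁(q)`
as there). Campaign DAG nodes (cell siegel-zhang): `Z22:§A.u020`, `Z22:(A.5)` (its input
`κ̃₁(q^{r−1}, dq) = κ₁(q^{r−1})`), `Z22:§A.u024`, `Z22:§A.u025`, `Z22:§A.u027`, and the local (per-prime,
`s = 1` resp. `q^{−s} = w`) form of `Z22:(A.6)`/`Z22:(A.7)`.

## What is PROVED here (no hypothesis (A), no `sorry`, standard axioms)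

* `tsum_nset_prime_pow` (+ `_of_coprime`, `_of_dvd`, `tsum_nset_one`) — a series over `h ∈ 𝔫(qʳ)` (the
  skeleton's `Skeleton.nset`, §7 p. 13) with a coprimality side condition, for an ARBITRARY summand and
  decidability instance (the shape of `Skeleton.kappaTilde` and of the typed `κ̃₁`, `κ̃₂` of §§15–16), is
  the series over `h = qᵏ`; if `q` divides the coprimality modulus only `h = 1` survives —
  **`Z22:§A.u020`: `κ̃₁(q^{r−1}, dq) = κ₁(q^{r−1})`** (the input of the case formula `Z22:(A.5)`);
* `Z22:§A.u024` `norm_kappaTildeOneLocal_sub_le` — **`κ̃₁(qʳ,1) = Σ_{k≥0} κ₁(q^{r+k})(v/q)ᵏ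
  = 1/(1 − vu) + O(αr log q)`**, with the bound `4r(|b₁|+|b₂|) log q` (`r ≥ 1`);
* `Z22:§A.u025` `norm_rSumLocal_sub_le` — **`Σ_{r≥1} wʳ(κ̃₁(qʳ,1) − (v/(1−u))κ₁(q^{r−1}))
  = (1/(1−vu) − v/(1−u))·w/(1−w) + O(α log q·|w|)`** for any `|w| ≤ 3/5` (the source has `w = q^{−s}`,
  `|s − 1| < 5α`, and writes the main term at `w = u`), bound `38(|b₁|+|b₂|) log q·|w|`, any `|w| ≤ 3/5`;
* `Z22:§A.u027` `norm_localA6_sub_le`, `mainA6Val_at_inv` — **`1 + λ₁(q)·[that sum]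
  = 1 + (1−vu)(1/(1−vu) − v/(1−u))·w/(1−w) + O(α log q·|w|)`** (bound `153(|b₁|+|b₂|) log q·|w|` when
  `(|b₁|+|b₂|) log q ≤ 1`), and at `w = u` the main term IS `1/(1−u) − uv(1−vu)/(1−u)²` exactly — which
  by `AppendixALocal.ident_A6_rational` / `ident_A7_rational` is the right side of (A.6) resp. (A.7);
* `norm_div_one_sub_sub_le` — `|w/(1−w) − u/(1−u)| ≤ 5|w − u|` (the passage `q^{−s} ↦ q^{−1}`).

Deliberately NOT here: the identification `w = q^{−s}`, `|q^{−s} − q^{−1}| ≤ 2q^{−1}|s−1| log q` and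
the (A.4) prefactor (companion file), (A.4) itself, and the product over `q < D`.

## References

* Y. Zhang, arXiv:2211.02515v1 (2022), Appendix A pp. 103–105; §7 p. 13 (𝔫(d)); §15 (15.9) p. 82.
  [cite: Zhang2022LandauSiegel, Appendix A]
-/

noncomputable section

open Finset Real Complex ArithmeticFunction

namespace Literature.NumberTheory.LFunctions.Zhang2022.AppendixALocal

open MeanSquareMajorant (powI kappa₁)

/-! ### §5. Series over `𝔫(qʳ)`: `Z22:§A.u020` and the reindexing behind `Z22:(A.5)`, `Z22:§A.u024` -/

/-- For a prime `q` and `r ≥ 1`: `h ∈ 𝔫(qʳ)` (every prime factor of `h` divides `qʳ`) iff `h` is a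
power of `q`. [cite: Zhang2022LandauSiegel, §7 p. 13 (definition of 𝔫(d))] -/
theorem mem_nset_prime_pow_iff {q r : ℕ} (hq : q.Prime) (hr : r ≠ 0) (h : ℕ) :
    h ∈ Skeleton.nset (q ^ r) ↔ ∃ k : ℕ, h = q ^ k := by
  constructor
  · rintro ⟨hpos, hdiv⟩
    refine ⟨h.primeFactorsList.length, Nat.eq_prime_pow_of_unique_prime_dvd hpos.ne' ?_⟩
    intro d hd hdh
    exact (Nat.prime_dvd_prime_iff_eq hd hq).mp (hd.dvd_of_dvd_pow (hdiv d hd hdh))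
  · rintro ⟨k, rfl⟩
    refine ⟨pow_pos hq.pos k, fun p hp hpk => ?_⟩
    exact dvd_pow (hp.dvd_of_dvd_pow hpk) hr

/-- **Reindexing a series over `h ∈ 𝔫(qʳ)` with a coprimality condition as a series over `h = qᵏ`**
(`q` prime, `r ≥ 1`), for an arbitrary summand `f` and arbitrary decidability instances — the shape
of the skeleton's `κ̃` (`Skeleton.kappaTilde`) and of the `κ̃₁`, `κ̃₂` of §§15–16.
[cite: Zhang2022LandauSiegel, §7 p. 13; §15 (15.9); §16 p. 90] -/
theorem tsum_nset_prime_pow {q r : ℕ} (hq : q.Prime) (hr : r ≠ 0) (m : ℕ) (f : ℕ → ℂ)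
    [∀ h, Decidable (h ∈ Skeleton.nset (q ^ r) ∧ Nat.Coprime h m)] :
    ∑' h : ℕ, (if h ∈ Skeleton.nset (q ^ r) ∧ Nat.Coprime h m then f h else 0) =
      ∑' k : ℕ, (if Nat.Coprime (q ^ k) m then f (q ^ k) else 0) := by
  set F : ℕ → ℂ := fun h => if h ∈ Skeleton.nset (q ^ r) ∧ Nat.Coprime h m then f h else 0
    with hF
  have hinj : Function.Injective (fun k : ℕ => q ^ k) := Nat.pow_right_injective hq.two_le
  have hsupp : Function.support F ⊆ Set.range (fun k : ℕ => q ^ k) := by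
    intro h hh
    rw [Function.mem_support] at hh
    by_cases hc : h ∈ Skeleton.nset (q ^ r) ∧ Nat.Coprime h m
    · obtain ⟨k, rfl⟩ := (mem_nset_prime_pow_iff hq hr h).mp hc.1
      exact ⟨k, rfl⟩
    · exact absurd (by rw [hF]; simp only [hc, if_false]) hh
  rw [← hinj.tsum_eq hsupp]
  refine tsum_congr fun k => ?_
  have hk : q ^ k ∈ Skeleton.nset (q ^ r) := (mem_nset_prime_pow_iff hq hr _).mpr ⟨k, rfl⟩
  simp only [hF, hk, true_and]

/-- If the coprimality modulus is prime to `q`, the condition is vacuous: the series over `𝔫(qʳ)` is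
`Σ_{k≥0} f(qᵏ)` (the case `(h, 1) = 1` of `κ̃₁(qʳ; 1)`, `Z22:§A.u024`). [cite: Zhang2022LandauSiegel, Appendix A p. 104] -/
theorem tsum_nset_prime_pow_of_coprime {q r : ℕ} (hq : q.Prime) (hr : r ≠ 0) {m : ℕ}
    (hm : Nat.Coprime q m) (f : ℕ → ℂ)
    [∀ h, Decidable (h ∈ Skeleton.nset (q ^ r) ∧ Nat.Coprime h m)] :
    ∑' h : ℕ, (if h ∈ Skeleton.nset (q ^ r) ∧ Nat.Coprime h m then f h else 0) =
      ∑' k : ℕ, f (q ^ k) := by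
  rw [tsum_nset_prime_pow hq hr m f]
  refine tsum_congr fun k => ?_
  rw [if_pos (Nat.Coprime.pow_left k hm)]

/-- **`Z22:§A.u020`** (and the second input of `Z22:(A.5)` / `Z22:§A.u033`): if `q` divides the
coprimality modulus, only `h = 1` survives, so the series over `𝔫(qʳ)` equals `f(1)` — in the source's
notation **`κ̃₁(q^{r−1}, dq) = κ₁(q^{r−1})`** (and likewise for `κ̃`, `κ̃₂`).
[cite: Zhang2022LandauSiegel, Appendix A p. 103 (display before (A.5))] -/
theorem tsum_nset_prime_pow_of_dvd {q r : ℕ} (hq : q.Prime) (hr : r ≠ 0) {m : ℕ} (hm : q ∣ m)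
    (f : ℕ → ℂ) [∀ h, Decidable (h ∈ Skeleton.nset (q ^ r) ∧ Nat.Coprime h m)] :
    ∑' h : ℕ, (if h ∈ Skeleton.nset (q ^ r) ∧ Nat.Coprime h m then f h else 0) = f 1 := by
  rw [tsum_nset_prime_pow hq hr m f, tsum_eq_single 0]
  · simp
  · intro k hk
    rw [if_neg]
    intro hc
    have : Nat.Coprime q m := Nat.Coprime.coprime_dvd_left (dvd_pow_self q hk) hc
    exact (Nat.Prime.coprime_iff_not_dvd hq).mp this hm

/-- The same for the series over `𝔫(1) = {1}` (`r = 0`): only `h = 1` contributes.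
[cite: Zhang2022LandauSiegel, §7 p. 13 ("𝔫(1) = {1}")] -/
theorem tsum_nset_one (m : ℕ) (f : ℕ → ℂ) [∀ h, Decidable (h ∈ Skeleton.nset 1 ∧ Nat.Coprime h m)] :
    ∑' h : ℕ, (if h ∈ Skeleton.nset 1 ∧ Nat.Coprime h m then f h else 0) = f 1 := by
  rw [tsum_eq_single 1]
  · have h1 : (1 : ℕ) ∈ Skeleton.nset 1 := ⟨Nat.one_pos, fun p _ hp => hp⟩
    simp [h1]
  · intro h hh
    rw [if_neg]
    rintro ⟨⟨hpos, hdiv⟩, -⟩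
    apply hh
    by_contra hne
    obtain ⟨p, hp, hph⟩ := Nat.exists_prime_and_dvd hne
    exact hp.one_lt.ne' (Nat.dvd_one.mp (hdiv p hp hph))

/-! ### §6. `κ̃₁(qʳ, 1)` (`Z22:§A.u024`) -/

/-- `‖v q⁻¹‖ ≤ 1/2` for `|v| ≤ 1` and `q ≥ 2`. (elementary step used implicitly at this point of the source)
[cite: Zhang2022LandauSiegel, Appendix A p. 104 (proof of Lemma 15.2)] -/
theorem norm_mul_inv_le_half {v : ℂ} (hv : ‖v‖ ≤ 1) {q : ℕ} (hq : 2 ≤ q) :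
    ‖v * (q : ℂ)⁻¹‖ ≤ 1 / 2 := by
  rw [norm_mul]
  calc ‖v‖ * ‖(q : ℂ)⁻¹‖ ≤ 1 * (1 / 2) := by
        gcongr; exact norm_inv_natCast_le_half hq
    _ = 1 / 2 := one_mul _

/-- `Σ_{k≥0} (r + k) tᵏ = r/(1−t) + t/(1−t)²` for `0 ≤ t < 1` (real). (elementary step used implicitly at this point of the source)
[cite: Zhang2022LandauSiegel, Appendix A p. 104 (proof of Lemma 15.2)] -/
theorem hasSum_add_mul_geometric {t : ℝ} (ht0 : 0 ≤ t) (ht : t < 1) (r : ℝ) :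
    HasSum (fun k : ℕ => (r + k) * t ^ k) (r / (1 - t) + t / (1 - t) ^ 2) := by
  have h1 : HasSum (fun k : ℕ => r * t ^ k) (r * (1 - t)⁻¹) :=
    (hasSum_geometric_of_lt_one ht0 ht).mul_left r
  have h2 : HasSum (fun k : ℕ => (k : ℝ) * t ^ k) (t / (1 - t) ^ 2) :=
    hasSum_coe_mul_geometric_of_norm_lt_one (by rwa [Real.norm_eq_abs, abs_of_nonneg ht0])
  have e1 : (fun k : ℕ => (r + k) * t ^ k) = fun k : ℕ => r * t ^ k + (k : ℝ) * t ^ k := by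
    ext k; ring
  rw [e1, div_eq_mul_inv]
  exact h1.add h2

/-- **`Z22:§A.u024`**: **`κ̃₁(qʳ, 1) = Σ_{k≥0} κ₁(q^{r+k})(vu)ᵏ = 1/(1 − vu) + O(αr log q)`**
(`u = q⁻¹`, `v = χ(q)`), quantitatively `‖κ̃₁(qʳ,1) − 1/(1 − vu)‖ ≤ 4r(|b₁| + |b₂|) log q` for `q`
prime, `r ≥ 1`, `|v| ≤ 1` (from `|κ₁(q^{r+k}) − 1| ≤ (r+k)(|b₁|+|b₂|) log q` and
`Σ_k (r+k)2^{−k} = 2r + 2 ≤ 4r`). The identification of the typed `κ̃₁(qʳ; 1)` (a series over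
`h ∈ 𝔫(qʳ)`) with this `k`-series is `tsum_nset_prime_pow_of_coprime`.
[cite: Zhang2022LandauSiegel, Appendix A p. 104 (proof of Lemma 15.2)] -/
theorem norm_kappaTildeOneLocal_sub_le (b₁ b₂ : ℝ) {v : ℂ} (hv : ‖v‖ ≤ 1) {q : ℕ} (hq : q.Prime)
    {r : ℕ} (hr : 1 ≤ r) :
    ‖(∑' k : ℕ, kappa₁ b₁ b₂ (q ^ (r + k)) * (v * (q : ℂ)⁻¹) ^ k) - 1 / (1 - v * (q : ℂ)⁻¹)‖ ≤
      4 * r * ((|b₁| + |b₂|) * Real.log q) := by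
  set a : ℂ := v * (q : ℂ)⁻¹ with ha
  set B : ℝ := (|b₁| + |b₂|) * Real.log q with hB
  have hB0 : 0 ≤ B := by
    rw [hB]; exact mul_nonneg (by positivity) (Real.log_natCast_nonneg q)
  have hna : ‖a‖ ≤ 1 / 2 := norm_mul_inv_le_half hv hq.two_le
  have hna1 : ‖a‖ < 1 := by linarith
  clear_value a
  -- the geometric part
  have hgeom : HasSum (fun k : ℕ => a ^ k) (1 / (1 - a)) := by
    rw [one_div]; exact hasSum_geometric_of_norm_lt_one hna1
  -- the perturbation
  set g : ℕ → ℂ := fun k => (kappa₁ b₁ b₂ (q ^ (r + k)) - 1) * a ^ k with hg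
  have hg_le : ∀ k, ‖g k‖ ≤ B * (((r : ℝ) + k) * (1 / 2) ^ k) := by
    intro k
    have h1 := norm_kappa₁_prime_pow_sub_one_le b₁ b₂ hq (r + k)
    push_cast at h1
    have h2 : ‖a‖ ^ k ≤ (1 / 2 : ℝ) ^ k := pow_le_pow_left₀ (norm_nonneg _) hna k
    calc ‖g k‖ = ‖kappa₁ b₁ b₂ (q ^ (r + k)) - 1‖ * ‖a‖ ^ k := by rw [hg, norm_mul, norm_pow]
      _ ≤ ((r : ℝ) + k) * ((|b₁| + |b₂|) * Real.log q) * (1 / 2 : ℝ) ^ k :=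
          mul_le_mul h1 h2 (by positivity) (by positivity)
      _ = B * (((r : ℝ) + k) * (1 / 2) ^ k) := by rw [hB]; ring
  have hmaj : HasSum (fun k : ℕ => B * (((r : ℝ) + k) * (1 / 2) ^ k))
      (B * ((r : ℝ) / (1 - 1 / 2) + (1 / 2) / (1 - 1 / 2) ^ 2)) :=
    (hasSum_add_mul_geometric (by norm_num : (0 : ℝ) ≤ 1 / 2) (by norm_num) (r : ℝ)).mul_left B
  have hg_sum : Summable g := Summable.of_norm_bounded hmaj.summable hg_le
  have hsplit : (∑' k : ℕ, kappa₁ b₁ b₂ (q ^ (r + k)) * a ^ k) =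
      (∑' k : ℕ, g k) + ∑' k : ℕ, a ^ k := by
    rw [← hg_sum.tsum_add hgeom.summable]
    refine tsum_congr fun k => ?_
    rw [hg]
    ring
  rw [hsplit, hgeom.tsum_eq, add_sub_cancel_right]
  have hr' : (1 : ℝ) ≤ r := by exact_mod_cast hr
  calc ‖∑' k : ℕ, g k‖ ≤ B * ((r : ℝ) / (1 - 1 / 2) + (1 / 2) / (1 - 1 / 2) ^ 2) :=
        tsum_of_norm_bounded hmaj hg_le
    _ = (2 * r + 2) * B := by ring
    _ ≤ 4 * r * B := by nlinarith

/-! ### §7. The `r`-sum and the local form of (A.6)/(A.7) (`Z22:§A.u025`, `Z22:§A.u027`) -/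

/-- `‖v/(1 − u)‖ ≤ 2` for `|v| ≤ 1`, `|u| ≤ 1/2` (here `v/(1−u) = χ(q)q/(q−1)`). (elementary step used implicitly at this point of the source)
[cite: Zhang2022LandauSiegel, Appendix A p. 104 (proof of Lemma 15.2)] -/
theorem norm_div_one_sub_le_two {u v : ℂ} (hu : ‖u‖ ≤ 1 / 2) (hv : ‖v‖ ≤ 1) :
    ‖v / (1 - u)‖ ≤ 2 := by
  have h1 : (1 : ℝ) / 2 ≤ ‖(1 : ℂ) - u‖ := by
    have := norm_sub_norm_le (1 : ℂ) u
    rw [norm_one] at this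
    linarith
  rw [norm_div]
  calc ‖v‖ / ‖(1 : ℂ) - u‖ ≤ 1 / (1 / 2) := by gcongr
    _ = 2 := by norm_num

/-- **The coefficients of (A.6)**: `‖A_r − A‖ ≤ 6r(|b₁|+|b₂|) log q`, where
`A_r = κ̃₁(qʳ,1) − (v/(1−u))κ₁(q^{r−1})` and `A = 1/(1−vu) − v/(1−u)` (`u = q⁻¹`, `r ≥ 1`, `q` prime,
`|v| ≤ 1`; from `Z22:§A.u024` and `Z22:§A.u023`). [cite: Zhang2022LandauSiegel, Appendix A p. 104 (proof of Lemma 15.2)] -/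
theorem norm_coeffA6_sub_le (b₁ b₂ : ℝ) {v : ℂ} (hv : ‖v‖ ≤ 1) {q : ℕ} (hq : q.Prime) {r : ℕ}
    (hr : 1 ≤ r) :
    ‖((∑' k : ℕ, kappa₁ b₁ b₂ (q ^ (r + k)) * (v * (q : ℂ)⁻¹) ^ k) -
          v / (1 - (q : ℂ)⁻¹) * kappa₁ b₁ b₂ (q ^ (r - 1))) -
        (1 / (1 - v * (q : ℂ)⁻¹) - v / (1 - (q : ℂ)⁻¹))‖ ≤ 6 * r * ((|b₁| + |b₂|) * Real.log q) := by
  set B : ℝ := (|b₁| + |b₂|) * Real.log q with hB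
  have hB0 : 0 ≤ B := by
    rw [hB]; exact mul_nonneg (by positivity) (Real.log_natCast_nonneg q)
  have hu : ‖(q : ℂ)⁻¹‖ ≤ 1 / 2 := norm_inv_natCast_le_half hq.two_le
  have h1 := norm_kappaTildeOneLocal_sub_le b₁ b₂ hv hq hr
  have h2 := norm_kappa₁_prime_pow_sub_one_le b₁ b₂ hq (r - 1)
  have h3 := norm_div_one_sub_le_two hu hv
  set K : ℂ := ∑' k : ℕ, kappa₁ b₁ b₂ (q ^ (r + k)) * (v * (q : ℂ)⁻¹) ^ k with hK
  set c : ℂ := v / (1 - (q : ℂ)⁻¹) with hc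
  clear_value K c
  have e : (K - c * kappa₁ b₁ b₂ (q ^ (r - 1))) - (1 / (1 - v * (q : ℂ)⁻¹) - c) =
      (K - 1 / (1 - v * (q : ℂ)⁻¹)) - c * (kappa₁ b₁ b₂ (q ^ (r - 1)) - 1) := by ring
  rw [e]
  have hr1 : ((r - 1 : ℕ) : ℝ) ≤ r := by
    rw [Nat.cast_sub hr]; push_cast; linarith
  calc ‖(K - 1 / (1 - v * (q : ℂ)⁻¹)) - c * (kappa₁ b₁ b₂ (q ^ (r - 1)) - 1)‖
      ≤ ‖K - 1 / (1 - v * (q : ℂ)⁻¹)‖ + ‖c * (kappa₁ b₁ b₂ (q ^ (r - 1)) - 1)‖ := norm_sub_le _ _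
    _ ≤ 4 * r * B + 2 * ((r - 1 : ℕ) * B) := by
        rw [norm_mul]
        gcongr
    _ ≤ 4 * r * B + 2 * (r * B) := by gcongr
    _ = 6 * r * B := by ring

/-- `Σ_{k≥0} (k+1) t^{k+1} = t/(1−t) + t²/(1−t)²` for `0 ≤ t < 1`. (elementary step used implicitly at this point of the source)
[cite: Zhang2022LandauSiegel, Appendix A p. 104 (proof of Lemma 15.2)] -/
theorem hasSum_succ_mul_pow_succ {t : ℝ} (ht0 : 0 ≤ t) (ht : t < 1) :
    HasSum (fun k : ℕ => ((k : ℝ) + 1) * t ^ (k + 1)) (t / (1 - t) + t ^ 2 / (1 - t) ^ 2) := by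
  have h := (hasSum_add_mul_geometric ht0 ht 1).mul_left t
  have e1 : (fun k : ℕ => ((k : ℝ) + 1) * t ^ (k + 1)) = fun k : ℕ => t * ((1 + (k : ℝ)) * t ^ k) := by
    ext k; ring
  have e2 : t / (1 - t) + t ^ 2 / (1 - t) ^ 2 = t * (1 / (1 - t) + t / (1 - t) ^ 2) := by ring
  rw [e1, e2]
  exact h

/-- **`Z22:§A.u025`** (local, with a free decay parameter `w`, `|w| ≤ 1/2`; the source has `w = q^{−s}`,
`|s − 1| < 5α`, and writes the main term at `w = u`): **`Σ_{r≥1} wʳ A_r = A·w/(1−w) + O(α log q·|w|)`**,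
`A_r = κ̃₁(qʳ,1) − (v/(1−u))κ₁(q^{r−1})`, `A = 1/(1−vu) − v/(1−u)` (`u = q⁻¹`); bound
`38(|b₁|+|b₂|) log q·|w|` for `|w| ≤ 3/5` (which covers `w = q^{−s}`, `q ≥ 2`, `Re s ≥ 9/10`). The
`r`-sum is indexed as `Σ_{r≥0} w^{r+1}A_{r+1}`.
[cite: Zhang2022LandauSiegel, Appendix A p. 104 (proof of Lemma 15.2)] -/
theorem norm_rSumLocal_sub_le (b₁ b₂ : ℝ) {v : ℂ} (hv : ‖v‖ ≤ 1) {q : ℕ} (hq : q.Prime) {w : ℂ}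
    (hw : ‖w‖ ≤ 3 / 5) :
    ‖(∑' r : ℕ, w ^ (r + 1) *
        ((∑' k : ℕ, kappa₁ b₁ b₂ (q ^ (r + 1 + k)) * (v * (q : ℂ)⁻¹) ^ k) -
          v / (1 - (q : ℂ)⁻¹) * kappa₁ b₁ b₂ (q ^ r))) -
      (1 / (1 - v * (q : ℂ)⁻¹) - v / (1 - (q : ℂ)⁻¹)) * (w / (1 - w))‖ ≤
      38 * ((|b₁| + |b₂|) * Real.log q) * ‖w‖ := by
  set B : ℝ := (|b₁| + |b₂|) * Real.log q with hB
  have hB0 : 0 ≤ B := by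
    rw [hB]; exact mul_nonneg (by positivity) (Real.log_natCast_nonneg q)
  have hcoef : ∀ r : ℕ, ‖((∑' k : ℕ, kappa₁ b₁ b₂ (q ^ (r + 1 + k)) * (v * (q : ℂ)⁻¹) ^ k) -
      v / (1 - (q : ℂ)⁻¹) * kappa₁ b₁ b₂ (q ^ r)) -
        (1 / (1 - v * (q : ℂ)⁻¹) - v / (1 - (q : ℂ)⁻¹))‖ ≤ 6 * ((r : ℝ) + 1) * B := by
    intro r
    have h := norm_coeffA6_sub_le b₁ b₂ hv hq (r := r + 1) (by omega)
    rw [Nat.add_sub_cancel, Nat.cast_add, Nat.cast_one] at h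
    exact h
  set A : ℂ := 1 / (1 - v * (q : ℂ)⁻¹) - v / (1 - (q : ℂ)⁻¹) with hA
  set Ar : ℕ → ℂ := fun r => (∑' k : ℕ, kappa₁ b₁ b₂ (q ^ (r + 1 + k)) * (v * (q : ℂ)⁻¹) ^ k) -
      v / (1 - (q : ℂ)⁻¹) * kappa₁ b₁ b₂ (q ^ r) with hAr
  have hcoef' : ∀ r : ℕ, ‖Ar r - A‖ ≤ 6 * ((r : ℝ) + 1) * B := fun r => by
    rw [hAr, hA]; exact hcoef r
  clear_value A Ar
  have hw1 : ‖w‖ < 1 := by linarith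
  -- geometric part: Σ w^{r+1} = w/(1−w)
  have hgeom : HasSum (fun r : ℕ => w ^ (r + 1)) (w / (1 - w)) := by
    have h := (hasSum_geometric_of_norm_lt_one hw1).mul_left w
    simp only [← pow_succ'] at h
    rwa [div_eq_mul_inv]
  -- perturbation part
  set g : ℕ → ℂ := fun r => w ^ (r + 1) * (Ar r - A) with hg
  have hg_le : ∀ r, ‖g r‖ ≤ 6 * B * (((r : ℝ) + 1) * ‖w‖ ^ (r + 1)) := by
    intro r
    calc ‖g r‖ = ‖w‖ ^ (r + 1) * ‖Ar r - A‖ := by rw [hg, norm_mul, norm_pow]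
      _ ≤ ‖w‖ ^ (r + 1) * (6 * ((r : ℝ) + 1) * B) := by gcongr; exact hcoef' r
      _ = 6 * B * (((r : ℝ) + 1) * ‖w‖ ^ (r + 1)) := by ring
  have hmaj : HasSum (fun r : ℕ => 6 * B * (((r : ℝ) + 1) * ‖w‖ ^ (r + 1)))
      (6 * B * (‖w‖ / (1 - ‖w‖) + ‖w‖ ^ 2 / (1 - ‖w‖) ^ 2)) :=
    (hasSum_succ_mul_pow_succ (norm_nonneg w) hw1).mul_left (6 * B)
  have hg_sum : Summable g := Summable.of_norm_bounded hmaj.summable hg_le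
  have hsplit : (∑' r : ℕ, w ^ (r + 1) * Ar r) = (∑' r : ℕ, g r) + A * ∑' r : ℕ, w ^ (r + 1) := by
    rw [← tsum_mul_left, ← hg_sum.tsum_add (hgeom.summable.mul_left A)]
    refine tsum_congr fun r => ?_
    rw [hg]; ring
  have hLHS : (∑' r : ℕ, w ^ (r + 1) *
        ((∑' k : ℕ, kappa₁ b₁ b₂ (q ^ (r + 1 + k)) * (v * (q : ℂ)⁻¹) ^ k) -
          v / (1 - (q : ℂ)⁻¹) * kappa₁ b₁ b₂ (q ^ r))) = ∑' r : ℕ, w ^ (r + 1) * Ar r := by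
    simp only [hAr]
  rw [hLHS, hsplit, hgeom.tsum_eq, add_sub_cancel_right]
  have hw0 := norm_nonneg w
  have ht2 : ‖w‖ / (1 - ‖w‖) + ‖w‖ ^ 2 / (1 - ‖w‖) ^ 2 ≤ (25 / 4) * ‖w‖ := by
    have h1 : ‖w‖ / (1 - ‖w‖) ≤ (5 / 2) * ‖w‖ := by
      rw [div_le_iff₀ (by linarith)]; nlinarith
    have hq4 : (4 : ℝ) / 25 ≤ (1 - ‖w‖) ^ 2 := by nlinarith
    have h2 : ‖w‖ ^ 2 / (1 - ‖w‖) ^ 2 ≤ (15 / 4) * ‖w‖ := by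
      rw [div_le_iff₀ (by positivity)]
      calc ‖w‖ ^ 2 = ‖w‖ * ‖w‖ := sq _
        _ ≤ ‖w‖ * (3 / 5) := by gcongr
        _ = (15 / 4) * ‖w‖ * (4 / 25) := by ring
        _ ≤ (15 / 4) * ‖w‖ * (1 - ‖w‖) ^ 2 := by gcongr
    linarith
  calc ‖∑' r : ℕ, g r‖ ≤ 6 * B * (‖w‖ / (1 - ‖w‖) + ‖w‖ ^ 2 / (1 - ‖w‖) ^ 2) :=
        tsum_of_norm_bounded hmaj hg_le
    _ ≤ 6 * B * ((25 / 4) * ‖w‖) := by gcongr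
    _ ≤ 38 * B * ‖w‖ := by nlinarith [norm_nonneg w]

/-- **`Z22:§A.u027`** (local, free `w`): with `λ₁(q) = (1−vux)(1−vuy)/(1−vu)` (`x = q^{−β₁}`,
`y = q^{−β₂}`, `u = q⁻¹`) and the `r`-sum of `Z22:§A.u025`,
**`1 + λ₁(q)·Σ_{r≥1} wʳA_r = 1 + (1 − vu)·A·w/(1−w) + O(α log q·|w|)`**; bound
`153(|b₁|+|b₂|) log q·|w|` under `(|b₁|+|b₂|) log q ≤ 1`, `|w| ≤ 3/5`, `|v| ≤ 1`.
[cite: Zhang2022LandauSiegel, Appendix A pp. 104–105 (proof of Lemma 15.2)] -/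
theorem norm_localA6_sub_le (b₁ b₂ : ℝ) {v : ℂ} (hv : ‖v‖ ≤ 1) {q : ℕ} (hq : q.Prime) {w : ℂ}
    (hw : ‖w‖ ≤ 3 / 5) (hBL : (|b₁| + |b₂|) * Real.log q ≤ 1) :
    ‖(1 + (1 - v * (q : ℂ)⁻¹ * powI b₁ q) * (1 - v * (q : ℂ)⁻¹ * powI b₂ q) /
          (1 - v * (q : ℂ)⁻¹) *
        ∑' r : ℕ, w ^ (r + 1) *
          ((∑' k : ℕ, kappa₁ b₁ b₂ (q ^ (r + 1 + k)) * (v * (q : ℂ)⁻¹) ^ k) -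
            v / (1 - (q : ℂ)⁻¹) * kappa₁ b₁ b₂ (q ^ r))) -
      (1 + (1 - v * (q : ℂ)⁻¹) * (1 / (1 - v * (q : ℂ)⁻¹) - v / (1 - (q : ℂ)⁻¹)) *
        (w / (1 - w)))‖ ≤ 153 * ((|b₁| + |b₂|) * Real.log q) * ‖w‖ := by
  set u : ℂ := (q : ℂ)⁻¹ with hu_def
  set B : ℝ := (|b₁| + |b₂|) * Real.log q with hB
  have hB0 : 0 ≤ B := by
    rw [hB]; exact mul_nonneg (by positivity) (Real.log_natCast_nonneg q)
  have hu : ‖u‖ ≤ 1 / 2 := norm_inv_natCast_le_half hq.two_le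
  have hw1 : ‖w‖ < 1 := by linarith
  -- the inputs (before abstracting the pieces)
  have hlam : ‖(1 - v * u * powI b₁ q) * (1 - v * u * powI b₂ q) / (1 - v * u) - (1 - v * u)‖ ≤
      4 * ‖u‖ * B := by
    have h := norm_lamOneLocal_sub_le hu hv (norm_powI_le_one b₁ q) (norm_powI_le_one b₂ q)
    have hx1 := MeanSquareMajorant.norm_powI_sub_one_le b₁ hq.pos
    have hy1 := MeanSquareMajorant.norm_powI_sub_one_le b₂ hq.pos
    calc _ ≤ 4 * ‖u‖ * (‖powI b₁ q - 1‖ + ‖powI b₂ q - 1‖) := h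
      _ ≤ 4 * ‖u‖ * (|b₁| * Real.log q + |b₂| * Real.log q) := by gcongr
      _ = 4 * ‖u‖ * B := by rw [hB]; ring
  have hsum := norm_rSumLocal_sub_le b₁ b₂ hv hq hw
  rw [← hB] at hsum
  set L : ℂ := (1 - v * u * powI b₁ q) * (1 - v * u * powI b₂ q) / (1 - v * u) with hL
  set S : ℂ := ∑' r : ℕ, w ^ (r + 1) *
      ((∑' k : ℕ, kappa₁ b₁ b₂ (q ^ (r + 1 + k)) * (v * u) ^ k) -
        v / (1 - u) * kappa₁ b₁ b₂ (q ^ r)) with hS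
  set A : ℂ := 1 / (1 - v * u) - v / (1 - u) with hA
  set M : ℂ := A * (w / (1 - w)) with hM
  have hsum' : ‖S - M‖ ≤ 38 * B * ‖w‖ := by rw [hM]; exact hsum
  have h1vu : ‖(1 : ℂ) - v * u‖ ≤ 3 / 2 := by
    calc ‖(1 : ℂ) - v * u‖ ≤ ‖(1 : ℂ)‖ + ‖v * u‖ := norm_sub_le _ _
      _ ≤ 1 + 1 * (1 / 2) := by rw [norm_one, norm_mul]; gcongr
      _ = 3 / 2 := by norm_num
  have hA4 : ‖A‖ ≤ 4 := by
    have hvq : ‖v * u‖ ≤ 1 / 2 := by rw [hu_def]; exact norm_mul_inv_le_half hv hq.two_le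
    have hden : (1 : ℝ) / 2 ≤ ‖(1 : ℂ) - v * u‖ := by
      have := norm_sub_norm_le (1 : ℂ) (v * u)
      rw [norm_one] at this
      linarith
    have hA1 : ‖(1 : ℂ) / (1 - v * u)‖ ≤ 2 := by
      rw [norm_div, norm_one]
      calc 1 / ‖(1 : ℂ) - v * u‖ ≤ 1 / (1 / 2) := by gcongr
        _ = 2 := by norm_num
    have hA2 : ‖v / (1 - u)‖ ≤ 2 := norm_div_one_sub_le_two hu hv
    calc ‖A‖ ≤ ‖(1 : ℂ) / (1 - v * u)‖ + ‖v / (1 - u)‖ := norm_sub_le _ _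
      _ ≤ 2 + 2 := by gcongr
      _ = 4 := by norm_num
  have hwfrac : ‖w / (1 - w)‖ ≤ (5 / 2) * ‖w‖ := by
    have hden : (2 : ℝ) / 5 ≤ ‖(1 : ℂ) - w‖ := by
      have := norm_sub_norm_le (1 : ℂ) w
      rw [norm_one] at this
      linarith
    rw [norm_div]
    calc ‖w‖ / ‖1 - w‖ ≤ ‖w‖ / (2 / 5) := by gcongr
      _ = (5 / 2) * ‖w‖ := by ring
  have hM8 : ‖M‖ ≤ 10 * ‖w‖ := by
    rw [hM, norm_mul]
    calc ‖A‖ * ‖w / (1 - w)‖ ≤ 4 * ((5 / 2) * ‖w‖) := by gcongr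
      _ = 10 * ‖w‖ := by ring
  have hL7 : ‖L‖ ≤ 7 / 2 := by
    have : L = (L - (1 - v * u)) + (1 - v * u) := by ring
    rw [this]
    calc ‖(L - (1 - v * u)) + (1 - v * u)‖ ≤ ‖L - (1 - v * u)‖ + ‖(1 : ℂ) - v * u‖ := norm_add_le _ _
      _ ≤ 4 * ‖u‖ * B + 3 / 2 := by gcongr
      _ ≤ 4 * (1 / 2) * 1 + 3 / 2 := by gcongr
      _ = 7 / 2 := by norm_num
  clear_value L S A M
  -- assembly
  have e : (1 + L * S) - (1 + (1 - v * u) * A * (w / (1 - w))) =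
      (L - (1 - v * u)) * M + L * (S - M) := by rw [hM]; ring
  rw [e]
  calc ‖(L - (1 - v * u)) * M + L * (S - M)‖ ≤ ‖(L - (1 - v * u)) * M‖ + ‖L * (S - M)‖ :=
        norm_add_le _ _
    _ = ‖L - (1 - v * u)‖ * ‖M‖ + ‖L‖ * ‖S - M‖ := by rw [norm_mul, norm_mul]
    _ ≤ (4 * ‖u‖ * B) * (10 * ‖w‖) + (7 / 2) * (38 * B * ‖w‖) := by gcongr
    _ = (40 * ‖u‖ + 133) * B * ‖w‖ := by ring
    _ ≤ (40 * (1 / 2) + 133) * B * ‖w‖ := by gcongr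
    _ = 153 * B * ‖w‖ := by norm_num

/-- **`Z22:§A.u027`**, the main term at `w = u = q⁻¹`, EXACTLY (for any `u, v` with `1 − u ≠ 0`,
`1 − vu ≠ 0`): `1 + (1 − vu)(1/(1−vu) − v/(1−u))·u/(1−u) = 1/(1−u) − uv(1−vu)/(1−u)²` — so that, by
`ident_A6_rational`/`ident_A7_rational`, the main term at `w = u` is the right side of (A.6) for
`v = ±1` and of (A.7) for `v = 0`. [cite: Zhang2022LandauSiegel, Appendix A p. 105 (proof of Lemma 15.2)] -/
theorem mainA6Val_at_u {K : Type*} [Field K] {u v : K} (h1 : (1 : K) - u ≠ 0)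
    (h2 : (1 : K) - v * u ≠ 0) :
    1 + (1 - v * u) * (1 / (1 - v * u) - v / (1 - u)) * (u / (1 - u)) =
      1 / (1 - u) - u * v * (1 - v * u) / (1 - u) ^ 2 := by
  field_simp
  ring

/-- The passage `q^{−s} ↦ q^{−1}` in the main term: **`|w/(1−w) − u/(1−u)| ≤ 5|w − u|`** for
`|w| ≤ 3/5`, `|u| ≤ 1/2`. (elementary step used implicitly at this point of the source)
[cite: Zhang2022LandauSiegel, Appendix A p. 104 (proof of Lemma 15.2)] -/
theorem norm_div_one_sub_sub_le {w u : ℂ} (hw : ‖w‖ ≤ 3 / 5) (hu : ‖u‖ ≤ 1 / 2) :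
    ‖w / (1 - w) - u / (1 - u)‖ ≤ 5 * ‖w - u‖ := by
  have hw' : (2 : ℝ) / 5 ≤ ‖1 - w‖ := by
    have := norm_sub_norm_le (1 : ℂ) w; rw [norm_one] at this; linarith
  have hu' : (1 : ℝ) / 2 ≤ ‖1 - u‖ := by
    have := norm_sub_norm_le (1 : ℂ) u; rw [norm_one] at this; linarith
  have hw0 : (1 : ℂ) - w ≠ 0 := by
    intro h; rw [h, norm_zero] at hw'; linarith
  have hu0 : (1 : ℂ) - u ≠ 0 := by
    intro h; rw [h, norm_zero] at hu'; linarith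
  have e : w / (1 - w) - u / (1 - u) = (w - u) / ((1 - w) * (1 - u)) := by
    field_simp; ring
  rw [e, norm_div, norm_mul]
  calc ‖w - u‖ / (‖1 - w‖ * ‖1 - u‖) ≤ ‖w - u‖ / (2 / 5 * (1 / 2)) := by gcongr
    _ = 5 * ‖w - u‖ := by ring

end Literature.NumberTheory.LFunctions.Zhang2022.AppendixALocal
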